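import Mathlib
import HarnessLib

/-!
# Route `PoloidalWindowDoor`, item `LrcModEntire` (stmt-NavierStokesRegularity-20428), cell (Q4-sonic) of the (TH) column —
# IN THE SONIC CELL THE RIDGE HEIGHT IS CONSTANT AND EVERY WEB POINT IS A HOT POINT (any branch shape)

Cell ns-regularity-ideate, LEAD-lineage seat ns-poloidal-K2-p3 g16 (`--supports stmt-NavierStokesRegularity-20428`; memo `Cruxes/LrcModEntire/T2B-g16-sonic.md` §2(b)).
From four conjuncts of the (Q4) package (skeleton twist_split v10, stub `stub_Q4sonic`) — the hot bound `√(−t)|U₂(t,x)| ≤ |U₂(−1,0)|`, the hot branch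
`U₂(−1,Γ s) = U₂(−1,0)`, the sign `σU₂(−1,0) = |U₂(−1,0)|`, and the web Fermat law at `τ = 0` (value + uniqueness of the cross-section maximiser) — together with the
SONIC literal (`R(0,·)` affine on `(−δ,δ)`): the affine function `R(0,·)` attains its maximum `|U₂(−1,0)|` at the interior point `z = 0`, hence is CONSTANT, so every web
point (at every height `|z| < δ`, over every point of the branch, straight or not) is a global maximum of `σU₂(−1,·)` — a HOT POINT.

* `sonic_ridge_height_const` — `R 0 z = |U₂(−1,0)|` for `|z| < δ`;
* `sonic_web_point_hot` — the maximiser `n₀` of the web Fermat law at `(0, z, s)` satisfies `σU₂(−1, Γ s + n₀ν_Γ s + z e₂) = |U₂(−1,0)|` and this is the global maximum.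

WHAT THIS IS NOT: not a claim about Navier–Stokes regularity — structure of the hypothetical object of a research cell; items 20428 / 19708 / 27893 OPEN.
-/

noncomputable section

set_option linter.dupNamespace false
set_option linter.unusedVariables false

namespace Summit.NavierStokesRegularity.NavierStokesRegularity.Theorems.PoloidalWindowDoorLrcModEntireQ4SonicHotSheet

open Set Function Filter Topology Metric

/-- **In the sonic cell the ridge height is the hot value.**  Hot bound + hot branch + web Fermat law at `τ = 0` + `R(0,·)` affine on `(−δ,δ)` ⇒ `R(0,z) = |U₂(−1,0)|`. -/
theorem sonic_ridge_height_const {U : ℝ → EuclideanSpace ℝ (Fin 3) → EuclideanSpace ℝ (Fin 3)} {Γ νΓ : ℝ → EuclideanSpace ℝ (Fin 3)} {R : ℝ → ℝ → ℝ}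
    {σ r δ : ℝ}
    (hUhotbd : ∀ t < 0, ∀ x, Real.sqrt (-t) * |U t x 2| ≤ |U (-1) 0 2|)
    (hσ : σ = 1 ∨ σ = -1) (hσN : σ * U (-1) 0 2 = |U (-1) 0 2|) (hΓhot : ∀ s, U (-1) (Γ s) 2 = U (-1) 0 2)
    (hr : 0 < r) (hδ : 0 < δ)
    (hweb : ∀ z₀ : ℝ, |z₀| < δ → ∀ s₀ : ℝ, ∃ n₀ ∈ Ioo (-r) r,
      σ * U (-1) (Γ s₀ + n₀ • νΓ s₀ + z₀ • EuclideanSpace.single 2 (1 : ℝ)) 2 = R 0 z₀ ∧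
      (∀ n ∈ Icc (-r) r, n ≠ n₀ → σ * U (-1) (Γ s₀ + n • νΓ s₀ + z₀ • EuclideanSpace.single 2 (1 : ℝ)) 2 < R 0 z₀))
    (hson : ∃ a b : ℝ, ∀ z : ℝ, |z| < δ → R 0 z = a + b * z) :
    ∀ z : ℝ, |z| < δ → R 0 z = |U (-1) 0 2| := by
  -- the signed component is bounded by the hot value
  have hle : ∀ x, σ * U (-1) x 2 ≤ |U (-1) 0 2| := by
    intro x
    have h1 : σ * U (-1) x 2 ≤ |U (-1) x 2| := by
      rcases hσ with h | h
      · rw [h, one_mul]; exact le_abs_self _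
      · rw [h, neg_one_mul]; exact neg_le_abs _
    have h2 := hUhotbd (-1) (by norm_num) x
    rw [neg_neg, Real.sqrt_one, one_mul] at h2
    exact h1.trans h2
  -- every ridge height is a value of the signed component, hence `≤ |N|`
  have hRle : ∀ z : ℝ, |z| < δ → R 0 z ≤ |U (-1) 0 2| := by
    intro z hz
    obtain ⟨n₀, -, hval, -⟩ := hweb z hz 0
    rw [← hval]; exact hle _
  -- at `z = 0` the height is the hot value (the branch point is on the cross-section)
  have h0δ : |(0 : ℝ)| < δ := by simpa using hδ
  have hR0 : R 0 0 = |U (-1) 0 2| := by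
    obtain ⟨n₀, hn₀, hval, huniq⟩ := hweb 0 h0δ 0
    have hΓ : σ * U (-1) (Γ 0 + (0 : ℝ) • νΓ 0 + (0 : ℝ) • EuclideanSpace.single 2 (1 : ℝ)) 2 = |U (-1) 0 2| := by
      rw [zero_smul, zero_smul, add_zero, add_zero, hΓhot, hσN]
    by_cases hn : (0 : ℝ) = n₀
    · rw [← hval, ← hn]; exact hΓ
    · have hlt := huniq 0 ⟨by linarith, by linarith⟩ hn
      rw [hΓ] at hlt
      linarith [hRle 0 h0δ]
  -- an affine function with an interior maximum is constant
  obtain ⟨a, b, hab⟩ := hson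
  have ha : a = |U (-1) 0 2| := by have h := hab 0 h0δ; rw [mul_zero, add_zero] at h; rw [← h, hR0]
  have hb : b = 0 := by
    have hδ2 : |δ / 2| < δ := by rw [abs_of_pos (by linarith)]; linarith
    have hδ2' : |-(δ / 2)| < δ := by rw [abs_neg]; exact hδ2
    have h1 := hRle (δ / 2) hδ2
    have h2 := hRle (-(δ / 2)) hδ2'
    rw [hab _ hδ2, ha] at h1
    rw [hab _ hδ2', ha] at h2
    nlinarith
  intro z hz
  rw [hab z hz, ha, hb, zero_mul, add_zero]

/-- **In the sonic cell every web point is a hot point.**  The maximiser of the web Fermat law at `(0, z, s)` carries the value `|U₂(−1,0)|`, the global maximum of `σU₂(−1,·)`. -/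
theorem sonic_web_point_hot {U : ℝ → EuclideanSpace ℝ (Fin 3) → EuclideanSpace ℝ (Fin 3)} {Γ νΓ : ℝ → EuclideanSpace ℝ (Fin 3)} {R : ℝ → ℝ → ℝ}
    {σ r δ : ℝ}
    (hUhotbd : ∀ t < 0, ∀ x, Real.sqrt (-t) * |U t x 2| ≤ |U (-1) 0 2|)
    (hσ : σ = 1 ∨ σ = -1) (hσN : σ * U (-1) 0 2 = |U (-1) 0 2|) (hΓhot : ∀ s, U (-1) (Γ s) 2 = U (-1) 0 2)
    (hr : 0 < r) (hδ : 0 < δ)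
    (hweb : ∀ z₀ : ℝ, |z₀| < δ → ∀ s₀ : ℝ, ∃ n₀ ∈ Ioo (-r) r,
      σ * U (-1) (Γ s₀ + n₀ • νΓ s₀ + z₀ • EuclideanSpace.single 2 (1 : ℝ)) 2 = R 0 z₀ ∧
      (∀ n ∈ Icc (-r) r, n ≠ n₀ → σ * U (-1) (Γ s₀ + n • νΓ s₀ + z₀ • EuclideanSpace.single 2 (1 : ℝ)) 2 < R 0 z₀))
    (hson : ∃ a b : ℝ, ∀ z : ℝ, |z| < δ → R 0 z = a + b * z) {z : ℝ} (hz : |z| < δ) (s : ℝ) {n₀ : ℝ}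
    (hn₀ : σ * U (-1) (Γ s + n₀ • νΓ s + z • EuclideanSpace.single 2 (1 : ℝ)) 2 = R 0 z) :
    σ * U (-1) (Γ s + n₀ • νΓ s + z • EuclideanSpace.single 2 (1 : ℝ)) 2 = |U (-1) 0 2| ∧
      ∀ x, σ * U (-1) x 2 ≤ σ * U (-1) (Γ s + n₀ • νΓ s + z • EuclideanSpace.single 2 (1 : ℝ)) 2 := by
  have hR := sonic_ridge_height_const hUhotbd hσ hσN hΓhot hr hδ hweb hson z hz
  have hval : σ * U (-1) (Γ s + n₀ • νΓ s + z • EuclideanSpace.single 2 (1 : ℝ)) 2 = |U (-1) 0 2| := by rw [hn₀, hR]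
  refine ⟨hval, fun x => ?_⟩
  rw [hval]
  have h1 : σ * U (-1) x 2 ≤ |U (-1) x 2| := by
    rcases hσ with h | h
    · rw [h, one_mul]; exact le_abs_self _
    · rw [h, neg_one_mul]; exact neg_le_abs _
  have h2 := hUhotbd (-1) (by norm_num) x
  rw [neg_neg, Real.sqrt_one, one_mul] at h2
  exact h1.trans h2

end Summit.NavierStokesRegularity.NavierStokesRegularity.Theorems.PoloidalWindowDoorLrcModEntireQ4SonicHotSheet

end
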